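import Mathlib.NumberTheory.Padics.Complex
import Mathlib.RingTheory.FreeRing
import Mathlib.Algebra.FreeAlgebra
import Literature.NumberTheory.Automorphic.ResGLnCohomology
import HarnessLib

/-!
# Hecke relations on the cohomology of `Res_{K/ℚ} GL_n` with parallel algebraic coefficients
# are defined over `ℤ` (named fact: `ℚ̄_p`-integral relations are spanned by integer relations)

Topic `NumberTheory/Automorphic`; namespace `Literature.NumberTheory.Automorphic`, grouping
sub-namespace `ResGLnCohomology` (that of the receptacle
`ResGLnCohomology.levelCohomology k n K 𝔫 λ q = H^q(GL_n(K)⁺, Fun(GL_n(𝔸_K^∞)/K_f(𝔫), E_λ(k)))`,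
`E_λ = ⊗_{τ : K →+* k} V_{λ_τ}`, with its unramified Hecke operators `heckeT … v i = T_{v,i}`,
`ResGLnCohomology.lean`).  ONE NAMED FACT (`def … : Prop`, D-0014), the RATIONALITY of the Hecke
module of a finite family of these receptacles with PARALLEL weights, stated in "relation currency"
(the only form in which the receptacle over `k = ℚ̄_p = PadicAlgCl p` can express it without a
base-change theorem for `groupCohomology`):

* `ResGLnCohomology.heckeRelations_definedOverInt` — for ANY number field `K`, any `n`, a level
  `𝔫 ≠ 0`, a prime `p`, and finitely many receptacles
  `M_k = H^{q_k}(S_{K_f(𝔫)}, Ẽ_{λ_k}(ℚ̄_p))` (`levelCohomology (PadicAlgCl p) n K 𝔫 (λ_k) (q_k)`,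
  `k < m`) whose weights `λ_k : (K →+* ℚ̄_p) → (Fin n → ℤ)` are PARALLEL (`λ_k τ = λ_k τ'` for all
  embeddings `τ, τ'`), and finitely many letters `X_j ↦ T_{v_j,i_j}` at places `v_j ∤ 𝔫`: every
  non-commutative polynomial `P ∈ ℚ̄_p⟨X_1,…,X_r⟩` with `p`-adically INTEGRAL coefficients (all of
  norm `≤ 1`) which is a RELATION on the family (`P(T) = 0` on every `M_k`) is a finite sum
  `P = Σ_i c_i Q_i` with `‖c_i‖ ≤ 1` and `Q_i ∈ ℤ⟨X_1,…,X_r⟩` (Mathlib `FreeRing (Fin r)`) integer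
  polynomials that are themselves relations on the family.  Equivalently: the `𝒪_{ℚ̄_p}`-module of
  integral relations is `𝒪_{ℚ̄_p} ⊗_ℤ (integer relations)`; equivalently the image of `ℤ⟨X⟩` in
  `∏_k End_{ℚ̄_p}(M_k)` (the `ℤ`-Hecke algebra of the family) tensored with `𝒪_{ℚ̄_p}` injects into
  `∏_k End_{ℚ̄_p}(M_k)` — "the Hecke algebra of the family is defined over `ℤ`".

## What is printed, and where

* Grobner–Raghuram 2014 (arXiv:1102.1872 numbering), §7.1 Lemma 37 ("Clozel [clozel], p.122"): for
  `G' = GL_m/D` over a number field `F` (here `D = F = K`, `G' = Res GL_n`) and a highest weight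
  representation `E_μ = ⊗_{v ∈ V_∞} E_{μ_v}` of `G'_∞`, "`ℚ(μ)` is a number field and `E_μ` is
  defined over its rationality field `ℚ(μ)`", where `ℚ(μ)` is the fixed field of
  `𝔖(E_μ) = {σ ∈ Aut(ℂ) | ^σE_μ ≅ E_μ}` and `^σ(⊗_v ν_v) = ⊗_v ν_{σ⁻¹v}` (loc. cit. §7.1, after
  Waldspurger).  For a PARALLEL weight (`μ_v = μ_{v'}` for all `v, v'`) every `σ` permutes the
  factors among themselves, `𝔖(E_μ) = Aut(ℂ)` and `ℚ(μ) = ℚ`: `E_μ` is defined over `ℚ`.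
* Grobner–Raghuram 2014, §7.2 Lemma 38: "The `G'(𝔸_f)`-modules `H^q(S_{G'}, ℰ_μ)` and
  `H^q_!(S_{G'}, ℰ_μ)` are defined over `ℚ(μ)`" — "sheaf-cohomology can be computed using
  Betti-cohomology … `H^q(S_{G'}, ℰ_μ) ≅ H^q_B(S_{G'}, E_{μ,ℚ(μ)}) ⊗_{ℚ(μ)} ℂ`"; "Compare … Clozel
  [clozel], p.122-123" (Clozel 1990, §3.5, the `ℚ(λ)`-rational structure on `H^•(S̃, Ẽ_λ)` used in
  the proof of Thm. 3.13).  At finite level `K_f(𝔫)` the `K_f(𝔫)`-invariants and the double-coset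
  operators `T_{v,i} = [K_f(𝔫) t_{v,i} K_f(𝔫)]` are `ℚ(μ)`-rational (characteristic `0`).
  The carrier `S_{G'} = G'(F)\G'(𝔸)/K'°_∞` with `ℝ_+` hidden in `K'°_∞` is, at level `K_f(𝔫)`, the
  model `GL_n(K)⁺\(X⁺ × G(𝔸_f)/K_f(𝔫))` of `levelCohomology` (see `ResGLnCohomology.lean`,
  module docstring, and [GrobnerRaghuram2014, §7.2]); the statement is insensitive to replacing
  `ℂ` by the abstractly isomorphic `ℚ̄_p` (`E_λ`, the cohomology and the Hecke operators are
  defined uniformly in the coefficient field, as everywhere in the tree: cf.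
  `ResGL2EigensystemCuspidalOrEisenstein.lean`, "Lean rendering").
* The passage from "defined over `ℚ`" to the integral statement recorded below is linear
  algebra, written out so that every step is visible.  Let `M_ℚ` be a Hecke-stable `ℚ`-form of
  `M = ⊕_k M_k`, `B_ℤ` the image of `ℤ⟨X⟩ → End_ℚ(M_ℚ) ⊆ End_{ℚ̄_p}(M)`, `𝔞_ℤ` its kernel (the
  integer relations) and `𝒪 = 𝒪_{ℚ̄_p} = {‖c‖ ≤ 1}`.  `B_ℤ` is a torsion-free `ℤ`-module, and `𝒪`
  is a torsion-free, hence FLAT, `ℤ`-module [cite: StacksProject, Tag 0AUW] (a module over a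
  Dedekind domain is flat iff torsion-free; Mathlib `IsDedekindDomain.flat_iff_torsion_eq_bot`).
  Tensoring `0 → 𝔞_ℤ → ℤ⟨X⟩ → B_ℤ → 0` with `𝒪` gives `0 → 𝒪 ⊗ 𝔞_ℤ → 𝒪⟨X⟩ → 𝒪 ⊗_ℤ B_ℤ → 0`, and
  `𝒪 ⊗_ℤ B_ℤ` is a torsion-free `𝒪`-module (`B_ℤ` flat over `ℤ`), so
  `𝒪 ⊗_ℤ B_ℤ ↪ ℚ̄_p ⊗_ℤ B_ℤ = ℚ̄_p ⊗_ℚ B_ℚ ↪ ℚ̄_p ⊗_ℚ End_ℚ(M_ℚ) = End_{ℚ̄_p}(M)`.  Hence an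
  `𝒪`-integral `P` with `P(T) = 0` in `End(M)` has image `0` in `𝒪 ⊗ B_ℤ`, i.e. lies in
  `𝒪 ⊗ 𝔞_ℤ = {Σ c_i Q_i : c_i ∈ 𝒪, Q_i ∈ 𝔞_ℤ}` — the statement below.  (No lattice, no
  integrality of the `T_{v,i}` and no finite generation of `B_ℤ` is needed; the weights may have
  negative parts.)

## Lean rendering and design

* Relation currency, exactly as in the consumers (route `Langlands/EisensteinGelfandKirillov`,
  crux `CrystallineProModularClassical`, line `torsion-weight-exchange`, whose line vocabulary
  `IsIntegralPoly` / `FactorsThroughClassicalModP` quantifies over `ℚ̄_p`-polynomials with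
  integral coefficients): `P : FreeAlgebra (PadicAlgCl p) (Fin r)`, integrality as
  `∀ w, ‖(FreeAlgebra.equivMonoidAlgebraFreeMonoid P).coeff w‖ ≤ 1` (Mathlib's monoid-algebra
  model of the free algebra), integer polynomials as Mathlib `FreeRing (Fin r)` mapped into
  `ℚ̄_p⟨X⟩` by `FreeRing.lift (FreeAlgebra.ι ℚ̄_p)` and evaluated by `FreeRing.lift`.
* PARALLEL weights only (`∀ k τ τ', lams k τ = lams k τ'`): then each `E_{λ_k}` is defined over
  `ℚ` and so is every finite family.  TODO(general form): Galois-stable families of arbitrary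
  weights (defined over `ℚ` as a whole), interior cohomology, coefficient fields other than `ℚ̄_p`.
* ANY number field `K`, any `n`, any degrees `q_k`, letters `(v_j, i_j)` with `v_j ∤ 𝔫` and any
  `i_j : ℕ` (`T_{v,0} = 1`, `T_{v,i} = T_{v,n}` for `i ≥ n`, all rational); `𝔫 ≠ 0` (at `𝔫 = 0`
  the level is junk).
* Why a named fact and not a theorem: the tree has the Hecke-compatible semilinear conjugation
  maps on these cohomology groups (`ArithmeticQuotient.cohomologySemimap`,
  `TwistedQuotient.cohomologySemimap`, `cohomologySemimap_heckeEnd`), but neither the `ℚ`-form of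
  `E_λ` for parallel `λ`, nor universal coefficients for `groupCohomology` under a field
  extension, nor Galois descent along `ℚ̄_p/ℚ`; the statement is recorded as
  printed-modulo-linear-algebra and taken as a hypothesis
  `(h : ResGLnCohomology.heckeRelations_definedOverInt)` by its consumer (stub S2' of the line
  above, together with `BigHeckeGLn.Scholze2015_gl2TowerHeckeRelations_classical`).
  `lean search 'definedOver\|heckeRelations\|RationalRelations'`: only the unrelated
  `bmm2016_hodgePQ_definedOverQ` (ball quotients).

## References

* H. Grobner, A. Raghuram, *On some arithmetic properties of automorphic forms of GL_m over a
  division algebra*, Int. J. Number Theory 10 (2014) = arXiv:1102.1872, §7.1 Lemma 37, §7.2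
  Lemma 38 (held; read 2026-08-17). [GrobnerRaghuram2014]
* L. Clozel, *Motifs et formes automorphes: applications du principe de fonctorialité* (1990),
  §3.5, pp. 122–123. [Clozel1990]
* The Stacks Project, Tag 0AUW (flat = torsion-free over a Dedekind domain). [StacksProject]
-/

noncomputable section

open scoped NumberField
open IsDedekindDomain NumberField

namespace Literature.NumberTheory.Automorphic

namespace ResGLnCohomology

/-- NAMED FACT — **the Hecke relations on a finite family of receptacles
`H^{q_k}(S_{K_f(𝔫)}, Ẽ_{λ_k}(ℚ̄_p))` of `Res_{K/ℚ} GL_n` with PARALLEL weights are defined over `ℤ`.**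
For any number field `K`, any `n`, a prime `p`, a level `𝔫 ≠ 0`, finitely many parallel weights
`λ_k` (`λ_k τ = λ_k τ'` for all embeddings `τ, τ' : K →+* ℚ̄_p`) and degrees `q_k`, and letters
`X_j ↦ T_{v_j, i_j}` (`heckeT`, `v_j ∤ 𝔫`): every `P ∈ ℚ̄_p⟨X_1, …, X_r⟩` with integral coefficients
(all of norm `≤ 1` in the monoid-algebra model) such that `P(T) = 0` on EVERY
`levelCohomology (PadicAlgCl p) n K 𝔫 (λ_k) (q_k)` is a finite sum `Σ_i c_i • Q_i` with `‖c_i‖ ≤ 1`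
and integer non-commutative polynomials `Q_i ∈ ℤ⟨X_1, …, X_r⟩` (`FreeRing (Fin r)`, mapped to
`ℚ̄_p⟨X⟩` by `FreeRing.lift (FreeAlgebra.ι ℚ̄_p)`) each of which is again a relation on every member.
Printed: `E_μ` is defined over its rationality field `ℚ(μ)` — which is `ℚ` for parallel `μ`, every
`σ ∈ Aut(ℂ)` permuting the factors of `⊗_v E_{μ_v}` — [cite: GrobnerRaghuram2014, §7.1 Lemma 37]
(after [cite: Clozel1990, §3.5 (p. 122)]), and the `G'(𝔸_f)`-modules `H^q(S_{G'}, ℰ_μ)` are defined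
over `ℚ(μ)`, Betti cohomology with coefficients in the `ℚ(μ)`-form giving the rational structure
[cite: GrobnerRaghuram2014, §7.2 Lemma 38]; hence the `ℚ̄_p`-relations among the (rational)
double-coset operators `T_{v,i}` on the finite-level invariants are spanned by `ℚ`-relations, and
since the integer Hecke algebra of the family is `ℤ`-torsion-free while `𝒪_{ℚ̄_p}` is torsion-free,
hence flat, over `ℤ` [cite: StacksProject, Tag 0AUW], the `𝒪_{ℚ̄_p}`-integral relations are
`𝒪_{ℚ̄_p} ⊗_ℤ (integer relations)` (module docstring, third bullet).  Unproved in the tree; users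
take `(h : ResGLnCohomology.heckeRelations_definedOverInt)`.  Special case (parallel weights,
`ℚ̄_p`) consumed by a route; general form TODO. -/
def heckeRelations_definedOverInt : Prop :=
  ∀ (n : ℕ) (K : Type) [Field K] [NumberField K] (p : ℕ) [Fact p.Prime] (𝔫 : Ideal (𝓞 K)),
    𝔫 ≠ 0 →
  ∀ (m : ℕ) (lams : Fin m → (K →+* PadicAlgCl p) → Fin n → ℤ) (qs : Fin m → ℕ),
    (∀ (k : Fin m) (τ τ' : K →+* PadicAlgCl p), lams k τ = lams k τ') →
  ∀ (r : ℕ) (ix : Fin r → HeightOneSpectrum (𝓞 K) × ℕ), (∀ j, ¬ (ix j).1.asIdeal ∣ 𝔫) →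
  ∀ P : FreeAlgebra (PadicAlgCl p) (Fin r),
    (∀ w, ‖(FreeAlgebra.equivMonoidAlgebraFreeMonoid P).coeff w‖ ≤ 1) →
    (∀ k : Fin m, FreeAlgebra.lift (PadicAlgCl p)
        (fun j => heckeT (PadicAlgCl p) n K 𝔫 (lams k) (qs k) (ix j).1 (ix j).2) P = 0) →
    ∃ (m' : ℕ) (c : Fin m' → PadicAlgCl p) (Q : Fin m' → FreeRing (Fin r)),
      (∀ i, ‖c i‖ ≤ 1) ∧
      (∀ (i : Fin m') (k : Fin m), FreeRing.lift
        (fun j => heckeT (PadicAlgCl p) n K 𝔫 (lams k) (qs k) (ix j).1 (ix j).2) (Q i) = 0) ∧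
      P = ∑ i, c i • FreeRing.lift (FreeAlgebra.ι (PadicAlgCl p)) (Q i)

end ResGLnCohomology

end Literature.NumberTheory.Automorphic
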